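import Literature.NumberTheory.Automorphic.EichlerZetaMeanValue
import Literature.NumberTheory.Automorphic.QuaternionIdealCountFactorization
import Literature.NumberTheory.Automorphic.QuaternionLocalDensityComparison
import Literature.NumberTheory.Automorphic.QuaternionLocalEichlerReduction
import Literature.NumberTheory.Automorphic.QuaternionLocalEichlerPair
import Literature.NumberTheory.Automorphic.EichlerOrderLocallyMaximal
import Literature.NumberTheory.Automorphic.QuaternionLocalRamified
import Literature.NumberTheory.Automorphic.QuaternionLocalSplitIdealCount
import Literature.NumberTheory.Automorphic.QuaternionLatticePointCount
import Literature.NumberTheory.Automorphic.QuaternionCovolumeTransporter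
import Literature.NumberTheory.Automorphic.QuaternionDiscriminantIndex
import Literature.NumberTheory.Automorphic.DefiniteOrderUnitsFinite
import Literature.NumberTheory.Automorphic.BrandtSetupAdmissible
import Literature.NumberTheory.Automorphic.BrandtModuleChains
import HarnessLib

/-!
# Eichler's mass formula over `ℚ` at every level `(N⁺, N⁻)`:
# `∑_{[I] ∈ Cls O} 1 / w_I = (1/12) ∏_{q ∣ N⁻} (q - 1) ∏_{p^k ∥ N⁺} p^{k-1} (p + 1)`
# — the discharge `brandtModule_massFormula_holds` of the tree's named fact

Topic `NumberTheory/Automorphic`; theorems only (no definition, no named fact, no instance).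
Let `P` be an Eichler package of level `(N⁺, N⁻)` (`BrandtModule.lean`): a definite quaternion
algebra `B` over `ℚ` ramified exactly at the primes dividing the squarefree `N⁻`, and an Eichler
order `O ⊆ B` of level `N⁺ ≥ 1`; `Cls O` its right class set, `w_I = #O_ℓ(I)ˣ / 2 = #Stab_{Bˣ}(I) / 2`
the Brandt weights (`BrandtData.ofOrder`). We prove **Eichler's mass formula**

  `∑_{[I] ∈ Cls O} 1 / w_I = φ(N⁻) ψ(N⁺) / 12`,  `ψ(N⁺) = ∏_{p^k ∥ N⁺} p^{k-1}(p + 1)`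

(Voight, *Quaternion Algebras*, GTM 288, Thm. 25.3.18; Vignéras, LNM 800, Ch. V §2 Cor. 2.3 at
`K = ℚ`; Eichler 1955), i.e. `theorem brandtModule_massFormula_holds : brandtModule_massFormula`.
The proof is the printed lattice-point proof (Voight §25.3, (25.3.1)–(25.3.14)), in the
Tauberian-free dress of the tree (`EichlerZetaMeanValue.lean`: mean values `N⁻² ∑_{n ≤ N}`
instead of residues of `ζ_O(s)`), assembled from theorems already in the tree:

* §A (Voight (25.3.2)–(25.3.7)) `EichlerPackage.tendsto_sum_card_integralIdeals_div_sq`: with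
  `a(n) = #{I ⊆ O invertible right O-ideal, [O : I] = n²}` — multiplicative
  (`QuaternionIdealCountFactorization.lean`), `a(p^k) = σ₁(p^k)` for `p ∤ N⁺N⁻`
  (`card_principal_ideals_of_split`), `∑_k a(p^k) p^{-2k} = (1 - p⁻²)⁻¹` for `p ∣ N⁻`
  (`hasSum_card_principal_div_pow_of_ramified`) and `= (1 - p⁻¹)⁻²` for `p ∣ N⁺` (Eichler model,
  `ncard_image_stabilizer_of_eichler`, `tendsto_density_normLevel_compl_of_le`) — one gets
  `N⁻² ∑_{n ≤ N} a(n) → (π²/12) ∏_{q ∣ N⁻} (q-1)/q · ∏_{p ∣ N⁺} (p+1)/p`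
  (`tendsto_sum_div_sq_of_multiplicative`); this is the definite twin of
  `ShimuraCurveData.tendsto_sum_card_integralIdeals_div_sq`.
* §B (Voight (25.3.8)–(25.3.9)) the integral ideals of the class of `I` are the `b • I`,
  `b ∈ I⁻¹ ∖ {0}`, `I⁻¹ = {x | x I ⊆ O}` (`transporterLeft I O`), each obtained from exactly
  `#Stab(I) = 2 w_I` units `b` (`natCard_subtype_smul_mem_eq`), with
  `[O : b • I] = nrd(b)² · covol(I)/covol(O)` (`cast_relIndex_units_smul_eq_sq_mul_covol_div`) — and `[O : J]` is a
  square for every integral invertible `J` (Kaplansky prime by prime,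
  `IsInvertibleRightIdeal.isSquare_relIndex`).
* §C (Voight Prop. 25.3.11, (25.3.12)) `#{b ∈ I⁻¹ | nrd b ≤ T} ~ (π²/2) T² / covol(I⁻¹)`
  (`tendsto_ncard_reducedNorm_le_div_sq`) with `covol(I⁻¹) covol(I) = covol(O)² = (N⁺N⁻/4)²`
  (`covol_transporterLeft_mul_covol`, `covol_eichler_eq`): the class of `I` contributes
  `2π²/(N⁺ N⁻ #Stab(I)) · N² + o(N²)` integral ideals of norm `≤ N`.
* §D (Voight (25.3.14)) summing over `Cls O` and comparing the two limits.

## References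

* J. Voight, *Quaternion Algebras*, GTM 288 (2021), §25.3: (25.3.1)–(25.3.14), Prop. 25.3.11,
  Thm. 25.3.15, Thm. 25.3.18 [Voight2021].
* M.-F. Vignéras, *Arithmétique des algèbres de quaternions*, LNM 800 (1980), Ch. V §2
  Prop. 2.2, Cor. 2.3 (formule de masse d'Eichler) [VignerasLNM800].
* M. Eichler, Zur Zahlentheorie der Quaternionen-Algebren, J. reine angew. Math. 195 (1955)
  127–151, §§3–4 [Eichler1955].
-/

noncomputable section

open Filter Finset
open scoped Pointwise Topology Real

namespace Literature.NumberTheory.Automorphic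

/-! ### §A. The arithmetic side: `N⁻² ∑_{n ≤ N} a(n) → (π²/12) ∏_{q ∣ N⁻} (1 - 1/q) ∏_{p ∣ N⁺} (1 + 1/p)` -/

namespace EichlerPackage

variable {Nplus Nminus : ℕ} (P : EichlerPackage Nplus Nminus)

/-- The algebra of an Eichler package is a division algebra (it is totally definite). [folklore] -/
private theorem forall_isUnit : ∀ x : P.B, x ≠ 0 → IsUnit x :=
  fun _ hx => isUnit_of_isTotallyDefinite P.B P.isTotallyDefinite hx

/-- The order of an Eichler package is a `ℤ`-order. [folklore] -/
private theorem isZOrder_O : IsZOrder P.O := P.isEichlerOrder.isZOrder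

/-- **`a(p^k) = σ₁(p^k)` at `p ∤ N⁺ N⁻`** for the Eichler order of a package: it is maximal at `p`
and `B` splits at `p`, so the principal right ideals of `O₍ₚ₎ ≅ M₂(ℤ_p)` of index `p^{2k}` are
counted by the Hermite normal forms (`card_principal_ideals_of_split`). [cite: Voight2021, §25.3 (25.3.5)] -/
theorem card_integralIdeals_prime_pow_of_not_dvd (hN : 0 < Nplus) {p : ℕ} (hp : p.Prime)
    (hpD : ¬ p ∣ Nminus) (hpM : ¬ p ∣ Nplus) (k : ℕ) :
    Nat.card {I : invertibleRightIdeals P.O // (I : Submodule ℤ P.B) ≤ P.O ∧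
        (I : Submodule ℤ P.B).toAddSubgroup.relIndex P.O.toAddSubgroup = (p ^ k) ^ 2} =
      ∑ i ∈ range (k + 1), p ^ i := by
  haveI : Fact p.Prime := ⟨hp⟩
  have hdiv := P.forall_isUnit
  obtain ⟨O₁, hO₁, -, hloc⟩ := P.isEichlerOrder.exists_isMaximalZOrder_localAt_eq hN.ne' hp hpM
  obtain ⟨φ⟩ := exists_algHom_matrix_of_not_dvd P.mem_ramifiedPlaces_iff hpD
  obtain ⟨u, hu⟩ := hO₁.exists_conjUnit_localAt_iff hdiv φ
  have hΛ : ∀ x : P.B, x ∈ localAt p P.O ↔ ∀ i j, ‖AlgHom.conjUnit φ u x i j‖ ≤ 1 := fun x => by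
    rw [hloc]; exact hu x
  rw [card_integralIdeals_prime_pow hdiv P.isZOrder_O hp k,
    card_principal_ideals_of_split hdiv (AlgHom.conjUnit φ u) P.isZOrder_O hΛ k]

/-- **The local factor at `p ∣ N⁻`**: `∑_k a(p^k) p^{-2k} = p⁴ / (p⁴ - p²) = (1 - p⁻²)⁻¹` (the
order is maximal at `p`, where `B_p` is a division algebra and `O₍ₚ₎ = {nrd ∈ ℤ₍ₚ₎}`). [cite: Voight2021, §25.3 (25.3.5)] -/
theorem hasSum_card_integralIdeals_of_dvd_disc {p : ℕ} (hp : p.Prime) (hpD : p ∣ Nminus) :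
    HasSum (fun k => (Nat.card {I : invertibleRightIdeals P.O // (I : Submodule ℤ P.B) ≤ P.O ∧
        (I : Submodule ℤ P.B).toAddSubgroup.relIndex P.O.toAddSubgroup = (p ^ k) ^ 2} : ℝ) /
        (p : ℝ) ^ (2 * k))
      ((p : ℝ) ^ 4 / ((p : ℝ) ^ 4 - (p : ℝ) ^ 2)) := by
  haveI : Fact p.Prime := ⟨hp⟩
  have hdiv := P.forall_isUnit
  have hT := isUnit_padicTensor_of_dvd P.B P.mem_ramifiedPlaces_iff hpD
  obtain ⟨O₁, hO₁, -, hloc⟩ := P.isEichlerOrder.exists_isMaximalZOrder_localAt_eq_of_padic_division hT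
  have hΛ : ∀ x : P.B, x ∈ localAt p P.O ↔ ¬ p ∣ (reducedNorm ℚ P.B x).den := fun x => by
    rw [hloc]; exact hO₁.mem_localAt_iff_of_ramified hdiv hT x
  have h := hasSum_card_principal_div_pow_of_ramified hdiv P.isZOrder_O hΛ
  convert h using 1
  funext k
  rw [card_integralIdeals_prime_pow hdiv P.isZOrder_O hp k]

/-- **The local factor at `p ∣ N⁺`**: `∑_k a(p^k) p^{-2k} = p⁴ / (p² (p - 1)²) = (1 - p⁻¹)⁻²`
(the local Eichler order of level `p^e`, `e = v_p(N⁺) ≥ 1`: unit count `p² (p - 1)²` modulo `p`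
and decay of the norm-level density inherited from the maximal order). [cite: Voight2021, Thm. 25.3.18 and Lemma 26.6.7] -/
theorem hasSum_card_integralIdeals_of_dvd_level (hN : 0 < Nplus) {p : ℕ} (hp : p.Prime)
    (hpM : p ∣ Nplus) :
    HasSum (fun k => (Nat.card {I : invertibleRightIdeals P.O // (I : Submodule ℤ P.B) ≤ P.O ∧
        (I : Submodule ℤ P.B).toAddSubgroup.relIndex P.O.toAddSubgroup = (p ^ k) ^ 2} : ℝ) /
        (p : ℝ) ^ (2 * k))
      ((p : ℝ) ^ 4 / ((p : ℝ) ^ 2 * ((p : ℝ) - 1) ^ 2)) := by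
  haveI : Fact p.Prime := ⟨hp⟩
  have hdiv := P.forall_isUnit
  have hpD : ¬ p ∣ Nminus := fun h =>
    hp.one_lt.ne' (Nat.Coprime.eq_one_of_dvd (P.coprime.coprime_dvd_left hpM) h)
  obtain ⟨O₁, O₂, hO₁, hO₂, hO, hidx⟩ := P.isEichlerOrder
  obtain ⟨φ⟩ := exists_algHom_matrix_of_not_dvd P.mem_ramifiedPlaces_iff hpD
  obtain ⟨Ψ, e, hΛ₁, hΛe⟩ := exists_eichler_model hdiv hO₁ hO₂ φ
  have hΛ : ∀ x : P.B, x ∈ localAt p P.O ↔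
      (∀ i j, ‖Ψ x i j‖ ≤ 1) ∧ ‖Ψ x 1 0‖ ≤ (p : ℝ) ^ (-(e : ℤ)) := fun x => by
    rw [hO]; exact hΛe x
  have hle : P.O ≤ O₁ := hO ▸ inf_le_left
  have hidx0 : P.O.toAddSubgroup.relIndex O₁.toAddSubgroup ≠ 0 := by rw [hidx]; exact hN.ne'
  -- `e ≥ 1` since `p ∣ N⁺`
  have he : 1 ≤ e := by
    by_contra he0
    have he0' : e = 0 := by omega
    have hloc : localAt p P.O = localAt p O₁ := by
      ext x
      rw [hΛ, hΛ₁, he0']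
      simp only [CharP.cast_eq_zero, neg_zero, zpow_zero]
      exact ⟨fun h => h.1, fun h => ⟨h, h 1 0⟩⟩
    have h := relIndex_localAt (p := p) O₁ P.O hle hidx0
    rw [hloc, AddSubgroup.relIndex_self, hidx] at h
    have h1 : 1 ≤ Nplus.factorization p := (hp.dvd_iff_one_le_factorization hN.ne').mp hpM
    have : p ^ 1 ≤ p ^ Nplus.factorization p := Nat.pow_le_pow_right hp.pos h1
    rw [← h, pow_one] at this
    exact absurd this (not_le.mpr hp.one_lt)
  -- decay of the density and the unit count
  have hY := tendsto_density_normLevel_compl_of_le P.isZOrder_O hO₁.1 hle hidx0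
    (tendsto_density_normLevel_compl_of_split hdiv Ψ hO₁.1 hΛ₁)
  have h := P.isZOrder_O.hasSum_card_principal_div_pow hY
  rw [ncard_image_stabilizer_of_eichler hdiv Ψ P.isZOrder_O he hΛ] at h
  have hcast : (((p ^ 2 * (p - 1) ^ 2 : ℕ)) : ℝ) = (p : ℝ) ^ 2 * ((p : ℝ) - 1) ^ 2 := by
    push_cast [Nat.cast_sub hp.one_le]
    ring
  rw [hcast] at h
  convert h using 1
  funext k
  rw [card_integralIdeals_prime_pow hdiv P.isZOrder_O hp k]

end EichlerPackage

/-- **The bad Euler factors**: `∏_{q ∣ D} (1-q⁻²)(1-q⁻¹)·q⁴/(q⁴-q²) · ∏_{p ∣ M} (1-p⁻²)(1-p⁻¹)·p⁴/(p²(p-1)²)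
 = ∏_{q ∣ D} (q - 1)/q · ∏_{p ∣ M} (p + 1)/p` for coprime `M, D`. [folklore] -/
private theorem prod_badFactors_eq_prod_div {D M : ℕ} (hcop : M.Coprime D) :
    ∏ p ∈ D.primeFactors ∪ M.primeFactors, ((1 - ((p : ℝ) ^ 2)⁻¹) * (1 - (p : ℝ)⁻¹) *
        (if p ∣ D then (p : ℝ) ^ 4 / ((p : ℝ) ^ 4 - (p : ℝ) ^ 2)
         else (p : ℝ) ^ 4 / ((p : ℝ) ^ 2 * ((p : ℝ) - 1) ^ 2))) =
      (∏ q ∈ D.primeFactors, (((q : ℝ) - 1) / q)) * ∏ p ∈ M.primeFactors, (((p : ℝ) + 1) / p) := by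
  rw [Finset.prod_union hcop.symm.disjoint_primeFactors]
  congr 1
  · refine Finset.prod_congr rfl fun p hp => ?_
    have hpp : p.Prime := Nat.prime_of_mem_primeFactors hp
    have hpd : p ∣ D := Nat.dvd_of_mem_primeFactors hp
    rw [if_pos hpd]
    have hp0 : (p : ℝ) ≠ 0 := by exact_mod_cast hpp.ne_zero
    have hp1 : (1 : ℝ) < p := by exact_mod_cast hpp.one_lt
    have hp21 : (p : ℝ) ^ 2 - 1 ≠ 0 := by nlinarith
    have hpm1 : (p : ℝ) - 1 ≠ 0 := by linarith
    have hpp1 : (p : ℝ) + 1 ≠ 0 := by linarith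
    rw [show (p : ℝ) ^ 4 - (p : ℝ) ^ 2 = (p : ℝ) ^ 2 * (((p : ℝ) - 1) * ((p : ℝ) + 1)) by ring]
    field_simp
    ring
  · refine Finset.prod_congr rfl fun p hp => ?_
    have hpp : p.Prime := Nat.prime_of_mem_primeFactors hp
    have hpm : p ∣ M := Nat.dvd_of_mem_primeFactors hp
    have hpd : ¬ p ∣ D := fun h =>
      hpp.one_lt.ne' (Nat.Coprime.eq_one_of_dvd (hcop.coprime_dvd_left hpm) h)
    rw [if_neg hpd]
    have hp0 : (p : ℝ) ≠ 0 := by exact_mod_cast hpp.ne_zero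
    have hp1 : (p : ℝ) - 1 ≠ 0 := by
      have : (1 : ℝ) < p := by exact_mod_cast hpp.one_lt
      linarith
    field_simp
    ring

namespace EichlerPackage

variable {Nplus Nminus : ℕ} (P : EichlerPackage Nplus Nminus)

/-- **`N⁻² ∑_{n ≤ N} a(n) → (π²/12) ∏_{q ∣ N⁻} (q-1)/q · ∏_{p ∣ N⁺} (p+1)/p`** for the Eichler
order `O` of a package of level `(N⁺, N⁻)`, `N⁺ ≥ 1`: the number `a(n)` of invertible right
`O`-ideals `I ⊆ O` of index `n²` has mean value `(π²/12) φ(N⁻)ψ(N⁺)/(N⁻N⁺)` — the "residue of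
`ζ_O(s)` at `s = 1`" (Voight (25.3.7) and the local count behind Thm. 25.3.18), here from
multiplicativity and the three kinds of local factors. [cite: Voight2021, §25.3 (25.3.2)–(25.3.7) and Thm. 25.3.18] -/
theorem tendsto_sum_card_integralIdeals_div_sq (hN : 0 < Nplus) :
    Tendsto (fun N : ℕ => (∑ n ∈ Icc 1 N, (Nat.card {I : invertibleRightIdeals P.O //
        (I : Submodule ℤ P.B) ≤ P.O ∧
          (I : Submodule ℤ P.B).toAddSubgroup.relIndex P.O.toAddSubgroup = n ^ 2} : ℝ)) / (N : ℝ) ^ 2)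
      atTop (𝓝 (π ^ 2 / 12 * ((∏ q ∈ Nminus.primeFactors, (((q : ℝ) - 1) / q)) *
        ∏ p ∈ Nplus.primeFactors, (((p : ℝ) + 1) / p)))) := by
  classical
  have hdiv := P.forall_isUnit
  have hD0 : Nminus ≠ 0 := P.nminus_ne_zero
  set a : ℕ → ℕ := fun n => Nat.card {I : invertibleRightIdeals P.O // (I : Submodule ℤ P.B) ≤ P.O ∧
    (I : Submodule ℤ P.B).toAddSubgroup.relIndex P.O.toAddSubgroup = n ^ 2} with ha
  set S : Finset ℕ := Nminus.primeFactors ∪ Nplus.primeFactors with hS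
  set A : ℕ → ℝ := fun p => if p ∣ Nminus then (p : ℝ) ^ 4 / ((p : ℝ) ^ 4 - (p : ℝ) ^ 2)
    else (p : ℝ) ^ 4 / ((p : ℝ) ^ 2 * ((p : ℝ) - 1) ^ 2) with hA
  have ha1 : a 1 = 1 := by
    rw [ha]; exact card_integralIdeals_one hdiv P.isZOrder_O
  have hmul : ∀ m n, m.Coprime n → a (m * n) = a m * a n := fun m n hmn =>
    card_integralIdeals_mul_of_coprime hdiv P.isZOrder_O m n hmn
  have hSprime : ∀ p ∈ S, p.Prime := by
    intro p hp
    rcases Finset.mem_union.mp hp with h | h <;> exact Nat.prime_of_mem_primeFactors h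
  have hgood : ∀ p, p.Prime → p ∉ S → ∀ k, a (p ^ k) = ∑ i ∈ range (k + 1), p ^ i := by
    intro p hp hpS k
    have hpD : ¬ p ∣ Nminus := fun h =>
      hpS (Finset.mem_union_left _ (Nat.mem_primeFactors.mpr ⟨hp, h, hD0⟩))
    have hpM : ¬ p ∣ Nplus := fun h =>
      hpS (Finset.mem_union_right _ (Nat.mem_primeFactors.mpr ⟨hp, h, hN.ne'⟩))
    exact P.card_integralIdeals_prime_pow_of_not_dvd hN hp hpD hpM k
  have hbad : ∀ p ∈ S, HasSum (fun k => (a (p ^ k) : ℝ) / (p : ℝ) ^ (2 * k)) (A p) := by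
    intro p hp
    have hpp := hSprime p hp
    by_cases hpD : p ∣ Nminus
    · rw [hA]; simp only [if_pos hpD]
      exact P.hasSum_card_integralIdeals_of_dvd_disc hpp hpD
    · have hpM : p ∣ Nplus := by
        rcases Finset.mem_union.mp hp with h | h
        · exact absurd (Nat.dvd_of_mem_primeFactors h) hpD
        · exact Nat.dvd_of_mem_primeFactors h
      rw [hA]; simp only [if_neg hpD]
      exact P.hasSum_card_integralIdeals_of_dvd_level hN hpp hpM
  have h := tendsto_sum_div_sq_of_multiplicative a ha1 hmul S hSprime hgood A hbad
  rw [prod_badFactors_eq_prod_div P.coprime] at h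
  exact h

end EichlerPackage


/-! ### §B. Integral ideals class by class (Voight (25.3.8)–(25.3.9)) -/

section General

/-- Perfect squares are detected by the parity of the exponents of the prime factorisation. [folklore] -/
private theorem isSquare_of_forall_even_factorization {n : ℕ} (hn : n ≠ 0)
    (h : ∀ p : ℕ, p.Prime → Even (n.factorization p)) : IsSquare n := by
  by_contra hns
  obtain ⟨t, s, ht, hs, hst, hsf⟩ := Nat.sq_mul_squarefree_of_pos (Nat.pos_of_ne_zero hn)
  have ht1 : t ≠ 1 := by
    rintro rfl
    exact hns ⟨s, by rw [← hst]; ring⟩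
  obtain ⟨p, hp, hpt⟩ := Nat.exists_prime_and_dvd ht1
  have htf : t.factorization p = 1 := by
    have hle := (Nat.squarefree_iff_factorization_le_one ht.ne').mp hsf p
    have hpos := hp.factorization_pos_of_dvd ht.ne' hpt
    omega
  have hodd : Odd (n.factorization p) := by
    rw [← hst, Nat.factorization_mul (pow_ne_zero 2 hs.ne') ht.ne', Nat.factorization_pow,
      Finsupp.add_apply, Finsupp.smul_apply, smul_eq_mul, htf]
    exact ⟨s.factorization p, rfl⟩
  exact (Nat.not_even_iff_odd.mpr hodd) (h p hp)

/-- **Orbit–stabiliser count over a subset of an orbit**: the elements `g` of a group moving `x₀`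
into a subset `T` of the orbit of `x₀` are `#T · #Stab(x₀)` in number (each point of `T` is hit by
exactly one coset of the stabiliser). [folklore] -/
private theorem natCard_subtype_smul_mem_eq {G X : Type*} [Group G] [MulAction G X] (x₀ : X)
    (T : Set X) (hT : T ⊆ MulAction.orbit G x₀) :
    Nat.card {g : G // g • x₀ ∈ T} = Nat.card T * Nat.card (MulAction.stabilizer G x₀) := by
  classical
  have hsec : ∀ y : T, ∃ g : G, g • x₀ = (y : X) := fun y => MulAction.mem_orbit_iff.mp (hT y.2)
  choose σ hσ using hsec
  rw [← Nat.card_prod]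
  refine Nat.card_congr ?_
  refine
    { toFun := fun g => ⟨⟨g.1 • x₀, g.2⟩, ⟨(σ ⟨g.1 • x₀, g.2⟩)⁻¹ * g.1, ?_⟩⟩
      invFun := fun yu => ⟨σ yu.1 * (yu.2 : G), ?_⟩
      left_inv := fun g => ?_
      right_inv := fun yu => ?_ }
  · rw [MulAction.mem_stabilizer_iff, mul_smul, inv_smul_eq_iff, hσ]
  · show (σ yu.1 * (yu.2 : G)) • x₀ ∈ T
    rw [mul_smul, MulAction.mem_stabilizer_iff.mp yu.2.2, hσ]
    exact yu.1.2
  · apply Subtype.ext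
    show σ _ * ((σ _)⁻¹ * g.1) = g.1
    rw [mul_inv_cancel_left]
  · obtain ⟨y, u⟩ := yu
    have hyx : (σ y * (u : G)) • x₀ = (y : X) := by
      rw [mul_smul, MulAction.mem_stabilizer_iff.mp u.2, hσ]
    have key : (⟨(σ y * (u : G)) • x₀, hyx.symm ▸ y.2⟩ : T) = y := Subtype.ext hyx
    refine Prod.ext ?_ (Subtype.ext ?_)
    · exact key
    · show (σ ⟨(σ y * (u : G)) • x₀, _⟩)⁻¹ * (σ y * (u : G)) = (u : G)
      rw [key, inv_mul_cancel_left]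

/-- When every non-zero element of `B` is a unit, the units satisfying a predicate are
in bijection with the non-zero elements satisfying it. [folklore] -/
private theorem natCard_units_subtype_eq {B : Type*} [Ring B] [Nontrivial B]
    (hdiv : ∀ x : B, x ≠ 0 → IsUnit x) (p : B → Prop) :
    Nat.card {g : Bˣ // p g} = Nat.card {b : B // b ≠ 0 ∧ p b} := by
  refine Nat.card_congr ?_
  exact
    { toFun := fun g => ⟨g.1, g.1.ne_zero, g.2⟩
      invFun := fun b => ⟨(hdiv b.1 b.2.1).unit, by rw [IsUnit.unit_spec]; exact b.2.2⟩
      left_inv := fun g => by apply Subtype.ext; apply Units.ext; exact (hdiv g.1 g.1.ne_zero).unit_spec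
      right_inv := fun b => by apply Subtype.ext; exact (hdiv b.1 b.2.1).unit_spec }

/-- `#{x | ∃ i ∈ s, Q i x} = ∑_{i ∈ s} #{x | Q i x}` for finite, pairwise incompatible fibres
(the finset-indexed form of `ncard_setOf_exists_mem_eq_sum` of `ShimuraCurveIdealCountBridge.lean`). [folklore] -/
private theorem ncard_setOf_exists_mem_finset_eq_sum {α ι : Type*} (s : Finset ι) (Q : ι → α → Prop)
    (hfin : ∀ i ∈ s, {x | Q i x}.Finite) (huniq : ∀ x i j, Q i x → Q j x → i = j) :
    {x | ∃ i ∈ s, Q i x}.Finite ∧ {x | ∃ i ∈ s, Q i x}.ncard = ∑ i ∈ s, {x | Q i x}.ncard := by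
  classical
  induction s using Finset.induction_on with
  | empty => simp
  | insert a s ha ih =>
    obtain ⟨ihfin, ihcard⟩ := ih fun n hn => hfin n (Finset.mem_insert_of_mem hn)
    have hset : {x | ∃ n ∈ insert a s, Q n x} = {x | Q a x} ∪ {x | ∃ n ∈ s, Q n x} := by
      ext x
      simp only [Finset.mem_insert, Set.mem_setOf_eq, Set.mem_union]
      constructor
      · rintro ⟨n, rfl | hn, hQ⟩
        · exact Or.inl hQ
        · exact Or.inr ⟨n, hn, hQ⟩
      · rintro (hQ | ⟨n, hn, hQ⟩)
        · exact ⟨a, Or.inl rfl, hQ⟩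
        · exact ⟨n, Or.inr hn, hQ⟩
    have hdisj : Disjoint {x | Q a x} {x | ∃ n ∈ s, Q n x} := by
      rw [Set.disjoint_left]
      rintro x hxa ⟨n, hn, hxn⟩
      exact ha (huniq x a n hxa hxn ▸ hn)
    have hfa := hfin a (Finset.mem_insert_self a s)
    rw [hset, Finset.sum_insert ha, Set.ncard_union_eq hdisj hfa ihfin, ihcard]
    exact ⟨hfa.union ihfin, rfl⟩

/-- `-1 ≠ 1` among the units of a non-trivial `ℚ`-algebra. [folklore] -/
private theorem units_neg_one_ne_one {B : Type*} [Ring B] [Algebra ℚ B] [Nontrivial B] :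
    (-1 : Bˣ) ≠ 1 := by
  intro h
  have h' : ((-1 : Bˣ) : B) = ((1 : Bˣ) : B) := by rw [h]
  rw [Units.val_neg, Units.val_one] at h'
  have h2 : (2 : B) = 0 := by
    have : (1 : B) + 1 = 0 := by
      calc (1 : B) + 1 = -1 + 1 := by rw [h']
        _ = 0 := by rw [neg_add_cancel]
    rw [← this]; norm_num
  have h2' : algebraMap ℚ B 2 = 0 := by rw [map_ofNat]; exact h2
  exact two_ne_zero ((algebraMap ℚ B).injective (by rw [h2', map_zero]))

/-- A subgroup of `Bˣ` containing `-1` has even order (`B` a non-trivial `ℚ`-algebra). [folklore] -/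
private theorem two_dvd_natCard_of_neg_one_mem {B : Type*} [Ring B] [Algebra ℚ B] [Nontrivial B]
    (H : Subgroup Bˣ) (hH : (-1 : Bˣ) ∈ H) : 2 ∣ Nat.card H := by
  haveI : Fact (Nat.Prime 2) := ⟨Nat.prime_two⟩
  have hord : orderOf (-1 : Bˣ) = 2 :=
    orderOf_eq_prime (by rw [sq, neg_mul_neg, one_mul]) units_neg_one_ne_one
  have h := Subgroup.orderOf_dvd_natCard H hH
  rwa [hord] at h

universe u

variable {B : Type u} [Ring B] [Algebra ℚ B] [IsQuaternionAlgebra ℚ B]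

omit [Algebra ℚ B] [IsQuaternionAlgebra ℚ B] in
/-- `b I ⊆ O ↔ b ∈ (O : I)_ℓ = {x | x I ⊆ O}` (`transporterLeft`; Voight (26.5.7): the elements of
`(O : I)_ℓ` index the ideals `b I ⊆ O`). [cite: Voight2021, (26.5.7)] -/
theorem units_smul_le_iff_mem_transporterLeft (b : Bˣ) (I O : Submodule ℤ B) :
    b • I ≤ O ↔ (b : B) ∈ transporterLeft I O := by
  constructor
  · intro h m hm
    have := h (Submodule.smul_mem_pointwise_smul m b I hm)
    rwa [Units.smul_def, smul_eq_mul] at this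
  · intro hb x hx
    obtain ⟨m, hm, rfl⟩ := (Submodule.mem_smul_pointwise_iff_exists x b I).mp hx
    rw [Units.smul_def, smul_eq_mul]
    exact hb m hm

omit [Algebra ℚ B] [IsQuaternionAlgebra ℚ B] in
/-- `-1` stabilises every lattice. [folklore] -/
private theorem neg_one_mem_stabilizer (I : Submodule ℤ B) : (-1 : Bˣ) ∈ MulAction.stabilizer Bˣ I := by
  rw [mem_stabilizer_submodule_iff, inv_neg_one, Units.val_neg, Units.val_one]
  exact ⟨fun y hy => by rw [neg_one_mul]; exact I.neg_mem hy,
    fun y hy => by rw [neg_one_mul]; exact I.neg_mem hy⟩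

/-- **`[O : J]` is a perfect square** for every integral invertible right ideal `J ⊆ O` of a
`ℤ`-order in a division quaternion algebra over `ℚ` (`N(J) = nrd(J)²`, Voight 16.4.10 / Main
Thm. 16.1.3): locally `J₍ₚ₎ = α O₍ₚ₎` (Kaplansky) has index `p^{2 v_p(nrd α)}`. [cite: Voight2021, §25.3 (25.3.1)–(25.3.2) and 16.4.10] -/
theorem IsInvertibleRightIdeal.isSquare_relIndex (hdiv : ∀ x : B, x ≠ 0 → IsUnit x)
    {O J : Submodule ℤ B} (hO : IsZOrder O) (hJ : IsInvertibleRightIdeal O J) (hJO : J ≤ O)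
    (h0 : J.toAddSubgroup.relIndex O.toAddSubgroup ≠ 0) :
    IsSquare (J.toAddSubgroup.relIndex O.toAddSubgroup) := by
  refine isSquare_of_forall_even_factorization h0 fun p hp => ?_
  haveI : Fact p.Prime := ⟨hp⟩
  obtain ⟨α, hαJ, hα⟩ := hJ.exists_localAt_eq_units_smul hdiv hO p
  have hαΛ : (α : B) ∈ localAt p O := le_localAt p O (hJO hαJ)
  obtain ⟨k, -, hk⟩ := exists_relIndex_units_smul_localAt_eq_pow hO α hαΛ
  have h := relIndex_localAt (p := p) O J hJO h0
  rw [hα, hk] at h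
  have h2 := Nat.pow_right_injective hp.two_le h
  exact ⟨k, by omega⟩

/-- The stabiliser `Stab_{Bˣ}(I) ≅ O_ℓ(I)ˣ` of a full lattice of a totally definite quaternion
algebra over `ℚ` is finite. [cite: Voight2021, Lemma 17.7.13] -/
theorem finite_stabilizer_of_isTotallyDefinite (hdef : IsTotallyDefinite ℚ B) {I : Submodule ℤ B}
    (hI : IsFullLattice B I) : Finite (MulAction.stabilizer Bˣ I) := by
  have hfin := finite_units_leftOrder hdef hI
  haveI := hfin.to_subtype
  refine Finite.of_injective (fun u : MulAction.stabilizer Bˣ I =>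
    (⟨((u : Bˣ) : B), ?_⟩ : {x : B | x ∈ Brandt.leftOrder I ∧
      ∃ y ∈ Brandt.leftOrder I, x * y = 1 ∧ y * x = 1})) ?_
  · obtain ⟨h1, h2⟩ := mem_stabilizer_submodule_iff.mp u.2
    exact ⟨h1, _, h2, (u : Bˣ).mul_inv, (u : Bˣ).inv_mul⟩
  · intro u v huv
    have h := congrArg Subtype.val huv
    exact Subtype.ext (Units.ext h)

/-- `#Stab_{Bˣ}(I) = 2 · (#Stab_{Bˣ}(I) / 2)`, i.e. `#O_ℓ(I)ˣ = 2 w_I` with the Brandt weight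
`w_I = #O_ℓ(I)ˣ / 2` of `BrandtData.ofOrder` (`±1` are units; Voight §25.3: `w_J = #O_L(J)ˣ/{±1}`). [cite: Voight2021, §25.3 before Prop. 25.3.11 (w_J = #O_L(J)ˣ/{±1})] -/
theorem natCard_stabilizer_eq_two_mul (I : Submodule ℤ B) :
    Nat.card (MulAction.stabilizer Bˣ I) = 2 * (Nat.card (MulAction.stabilizer Bˣ I) / 2) := by
  haveI : Nontrivial B := Module.nontrivial_of_finrank_pos (R := ℚ)
    (by rw [IsQuaternionAlgebra.finrank_eq_four (K := ℚ) (D := B)]; norm_num)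
  exact (Nat.mul_div_cancel' (two_dvd_natCard_of_neg_one_mem _ (neg_one_mem_stabilizer I))).symm

/-- **`[O : b I] = nrd(b)² · covol(I) / covol(O)`** for `b I ⊆ O` (covolumes of the Euclidean model:
`covol(b I) = nrd(b)² covol(I) = [O : bI] covol(O)`). [cite: Voight2021, §25.3 (25.3.9)] -/
theorem cast_relIndex_units_smul_eq_sq_mul_covol_div (hdef : IsTotallyDefinite ℚ B)
    (ψ : B →ₗ[ℚ] EuclideanSpace ℝ (Fin 4)) (hψs : Submodule.span ℝ (Set.range ψ) = ⊤)
    (hψn : ∀ x, ‖ψ x‖ ^ 2 = ((reducedNorm ℚ B x : ℚ) : ℝ))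
    {O I : Submodule ℤ B} (hO : IsZOrder O) (hI : IsFullLattice B I) (g : Bˣ) (hle : g • I ≤ O) :
    (((g • I).toAddSubgroup.relIndex O.toAddSubgroup : ℕ) : ℝ) =
      ((reducedNorm ℚ B (g : B) : ℚ) : ℝ) ^ 2 * (covol ψ I / covol ψ O) := by
  have hψi : Function.Injective ψ := injective_euclideanEmbedding ψ hψn hdef
  have h1 := covol_eq_relIndex_mul ψ hψs hψi hO.isFullLattice (hI.units_smul g) hle
  have h2 := covol_units_smul ψ hψs hI g
  have hO0 := covol_pos ψ hψs hO.isFullLattice (L := O)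
  rw [mul_div_assoc', eq_div_iff hO0.ne', ← h2, h1]

/-- **The integral ideals `b I ⊆ O` of norm `≤ N` correspond to the `b ∈ I⁻¹` with
`nrd(b) ≤ N · (covol O / covol I)^{1/2}`**: for `b ∈ Bˣ`, `b I ⊆ O` with `[O : bI] = n²`,
`1 ≤ n ≤ N`, iff `b ∈ (O : I)_ℓ` and `nrd(b) ≤ N c`, `c² = covol(O)/covol(I)` (the index of an
integral invertible ideal being automatically a square). [cite: Voight2021, §25.3 (25.3.8)–(25.3.9)] -/
theorem natCard_units_smul_le_eq (hdef : IsTotallyDefinite ℚ B)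
    (ψ : B →ₗ[ℚ] EuclideanSpace ℝ (Fin 4)) (hψs : Submodule.span ℝ (Set.range ψ) = ⊤)
    (hψn : ∀ x, ‖ψ x‖ ^ 2 = ((reducedNorm ℚ B x : ℚ) : ℝ))
    {O I : Submodule ℤ B} (hO : IsZOrder O) (hI : IsInvertibleRightIdeal O I)
    {c : ℝ} (hc : 0 < c) (hc2 : c ^ 2 = covol ψ O / covol ψ I) (N : ℕ) :
    Nat.card {g : Bˣ // g • I ≤ O ∧ ∃ n ∈ Icc 1 N,
        (g • I).toAddSubgroup.relIndex O.toAddSubgroup = n ^ 2} =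
      Nat.card {g : Bˣ // (g : B) ∈ transporterLeft I O ∧
        ((reducedNorm ℚ B (g : B) : ℚ) : ℝ) ≤ N * c} := by
  haveI : Nontrivial B := Module.nontrivial_of_finrank_pos (R := ℚ)
    (by rw [IsQuaternionAlgebra.finrank_eq_four (K := ℚ) (D := B)]; norm_num)
  have hdiv : ∀ x : B, x ≠ 0 → IsUnit x := fun x hx => isUnit_of_isTotallyDefinite B hdef hx
  have hIfull := hI.isFullLattice
  have hIO : 0 < covol ψ I / covol ψ O :=
    div_pos (covol_pos ψ hψs hIfull) (covol_pos ψ hψs hO.isFullLattice)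
  -- `c² · (covol I / covol O) = 1`
  have hcc : covol ψ I / covol ψ O * c ^ 2 = 1 := by
    rw [hc2]
    have h1 := (covol_pos ψ hψs hIfull (L := I)).ne'
    have h2 := (covol_pos ψ hψs hO.isFullLattice (L := O)).ne'
    field_simp
  refine Nat.card_congr (Equiv.subtypeEquivRight fun g => ?_)
  have hnrd0 : (0 : ℝ) ≤ ((reducedNorm ℚ B (g : B) : ℚ) : ℝ) := by
    exact_mod_cast (reducedNorm_pos_of_isTotallyDefinite B hdef g.ne_zero).le
  -- the index as a real number, for `g I ⊆ O`
  have hkey : ∀ (hle : g • I ≤ O) (m : ℕ),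
      (g • I).toAddSubgroup.relIndex O.toAddSubgroup = m ^ 2 →
        ((reducedNorm ℚ B (g : B) : ℚ) : ℝ) = m * c := by
    intro hle m hm
    have hr := cast_relIndex_units_smul_eq_sq_mul_covol_div hdef ψ hψs hψn hO hIfull g hle
    rw [hm] at hr
    push_cast at hr
    have hsq : ((m : ℝ) * c) ^ 2 = (((reducedNorm ℚ B (g : B) : ℚ) : ℝ)) ^ 2 := by
      rw [mul_pow, hr, mul_assoc, hcc, mul_one]
    exact ((pow_left_inj₀ (by positivity) hnrd0 two_ne_zero).mp hsq).symm
  constructor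
  · rintro ⟨hle, n, hn, hidx⟩
    refine ⟨(units_smul_le_iff_mem_transporterLeft g I O).mp hle, ?_⟩
    have hnN : (n : ℝ) ≤ N := by exact_mod_cast (Finset.mem_Icc.mp hn).2
    rw [hkey hle n hidx]
    exact mul_le_mul_of_nonneg_right hnN hc.le
  · rintro ⟨hL, hnrd⟩
    have hle := (units_smul_le_iff_mem_transporterLeft g I O).mpr hL
    refine ⟨hle, ?_⟩
    have hr := cast_relIndex_units_smul_eq_sq_mul_covol_div hdef ψ hψs hψn hO hIfull g hle
    have hr0 : (g • I).toAddSubgroup.relIndex O.toAddSubgroup ≠ 0 := by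
      intro h0
      rw [h0, Nat.cast_zero] at hr
      have hpos : (0 : ℝ) < ((reducedNorm ℚ B (g : B) : ℚ) : ℝ) ^ 2 * (covol ψ I / covol ψ O) :=
        mul_pos (by
          have := reducedNorm_pos_of_isTotallyDefinite B hdef g.ne_zero
          have h' : (0 : ℝ) < ((reducedNorm ℚ B (g : B) : ℚ) : ℝ) := by exact_mod_cast this
          positivity) hIO
      linarith
    obtain ⟨m, hm⟩ := (hI.units_smul g).isSquare_relIndex hdiv hO hle hr0
    have hm' : (g • I).toAddSubgroup.relIndex O.toAddSubgroup = m ^ 2 := by rw [hm, sq]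
    have hm0 : m ≠ 0 := by
      rintro rfl
      exact hr0 (by rw [hm])
    refine ⟨m, Finset.mem_Icc.mpr ⟨Nat.one_le_iff_ne_zero.mpr hm0, ?_⟩, hm'⟩
    have h := hkey hle m hm'
    rw [h] at hnrd
    have : (m : ℝ) ≤ N := le_of_mul_le_mul_right hnrd hc
    exact_mod_cast this

/-! ### §C. Lattice points of `I⁻¹` of bounded norm (Voight Prop. 25.3.11, (25.3.12)) -/

/-- The points of bounded norm of a full lattice: removing the origin costs one point. [folklore] -/
private theorem ncard_setOf_mem_reducedNorm_le_eq_succ (hdef : IsTotallyDefinite ℚ B) {L : Submodule ℤ B}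
    (hL : IsFullLattice B L) {T : ℝ} (hT : 0 ≤ T) :
    ({b : B | b ∈ L ∧ ((reducedNorm ℚ B b : ℚ) : ℝ) ≤ T}).ncard =
      ({b : B | b ≠ 0 ∧ (b ∈ L ∧ ((reducedNorm ℚ B b : ℚ) : ℝ) ≤ T)}).ncard + 1 := by
  have hfin : ({b : B | b ∈ L ∧ ((reducedNorm ℚ B b : ℚ) : ℝ) ≤ T}).Finite := by
    obtain ⟨t, ht⟩ := hL.1
    refine (finite_setOf_mem_span_reducedNorm_le hdef t (⌈T⌉₊ : ℚ)).subset ?_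
    rintro b ⟨hb, hbT⟩
    refine ⟨by rw [ht]; exact hb, ?_⟩
    have h : ((reducedNorm ℚ B b : ℚ) : ℝ) ≤ ((⌈T⌉₊ : ℚ) : ℝ) := by
      rw [Rat.cast_natCast]; exact hbT.trans (Nat.le_ceil T)
    exact_mod_cast h
  have hset : {b : B | b ∈ L ∧ ((reducedNorm ℚ B b : ℚ) : ℝ) ≤ T} =
      insert 0 {b : B | b ≠ 0 ∧ (b ∈ L ∧ ((reducedNorm ℚ B b : ℚ) : ℝ) ≤ T)} := by
    ext b
    simp only [Set.mem_insert_iff, Set.mem_setOf_eq]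
    constructor
    · rintro ⟨hb, hbT⟩
      by_cases h0 : b = 0
      · exact Or.inl h0
      · exact Or.inr ⟨h0, hb, hbT⟩
    · rintro (rfl | ⟨-, hb, hbT⟩)
      · refine ⟨L.zero_mem, ?_⟩
        rw [reducedNorm_apply_zero, Rat.cast_zero]; exact hT
      · exact ⟨hb, hbT⟩
  rw [hset, Set.ncard_insert_of_notMem (by simp) (hfin.subset (by
    rintro b ⟨-, hb⟩; exact hb))]

/-- **Lattice points of norm `≤ N c`**: `#{b ∈ L | nrd b ≤ N c} / N² → (π²/2) c² / covol(ψ L)`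
(`tendsto_ncard_reducedNorm_le_div_sq` along `T = N c`). [cite: Voight2021, Prop. 25.3.11 and (25.3.12)] -/
theorem tendsto_ncard_reducedNorm_le_mul_div_sq (hdef : IsTotallyDefinite ℚ B)
    (ψ : B →ₗ[ℚ] EuclideanSpace ℝ (Fin 4)) (hψs : Submodule.span ℝ (Set.range ψ) = ⊤)
    (hψn : ∀ x, ‖ψ x‖ ^ 2 = ((reducedNorm ℚ B x : ℚ) : ℝ))
    {L : Submodule ℤ B} (hL : IsFullLattice B L) {c : ℝ} (hc : 0 < c) :
    Tendsto (fun N : ℕ => (({b : B | b ∈ L ∧ ((reducedNorm ℚ B b : ℚ) : ℝ) ≤ N * c}).ncard : ℝ) /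
        (N : ℝ) ^ 2) atTop (𝓝 (π ^ 2 / 2 / covol ψ L * c ^ 2)) := by
  have h := tendsto_ncard_reducedNorm_le_div_sq hdef ψ hψs hψn hL
  have hNc : Tendsto (fun N : ℕ => (N : ℝ) * c) atTop atTop :=
    tendsto_natCast_atTop_atTop.atTop_mul_const hc
  have h2 := (h.comp hNc).mul_const (c ^ 2)
  refine h2.congr' ?_
  filter_upwards [eventually_ge_atTop 1] with N hN
  have hN0 : (N : ℝ) ≠ 0 := by
    have : (1 : ℝ) ≤ N := by exact_mod_cast hN
    positivity
  simp only [Function.comp_apply]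
  field_simp

/-- **The units `b ∈ I⁻¹` of norm `≤ N c`**: `#{b ∈ Bˣ ∩ L | nrd b ≤ N c} / N² → (π²/2) c² / covol(ψ L)`
(the origin is the only non-unit of `L`). [cite: Voight2021, Prop. 25.3.11 and (25.3.12)] -/
theorem tendsto_natCard_units_mem_div_sq (hdef : IsTotallyDefinite ℚ B)
    (ψ : B →ₗ[ℚ] EuclideanSpace ℝ (Fin 4)) (hψs : Submodule.span ℝ (Set.range ψ) = ⊤)
    (hψn : ∀ x, ‖ψ x‖ ^ 2 = ((reducedNorm ℚ B x : ℚ) : ℝ))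
    {L : Submodule ℤ B} (hL : IsFullLattice B L) {c : ℝ} (hc : 0 < c) :
    Tendsto (fun N : ℕ => (Nat.card {g : Bˣ // (g : B) ∈ L ∧
        ((reducedNorm ℚ B (g : B) : ℚ) : ℝ) ≤ N * c} : ℝ) / (N : ℝ) ^ 2)
      atTop (𝓝 (π ^ 2 / 2 / covol ψ L * c ^ 2)) := by
  haveI : Nontrivial B := Module.nontrivial_of_finrank_pos (R := ℚ)
    (by rw [IsQuaternionAlgebra.finrank_eq_four (K := ℚ) (D := B)]; norm_num)
  have hdiv : ∀ x : B, x ≠ 0 → IsUnit x := fun x hx => isUnit_of_isTotallyDefinite B hdef hx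
  have h1 := tendsto_ncard_reducedNorm_le_mul_div_sq hdef ψ hψs hψn hL hc
  have h0 : Tendsto (fun N : ℕ => (1 : ℝ) / (N : ℝ) ^ 2) atTop (𝓝 0) :=
    tendsto_const_nhds.div_atTop ((Filter.tendsto_pow_atTop two_ne_zero).comp
      tendsto_natCast_atTop_atTop)
  have h2 := h1.sub h0
  rw [sub_zero] at h2
  refine h2.congr' (Eventually.of_forall fun N => ?_)
  have hNc : (0 : ℝ) ≤ N * c := by positivity
  dsimp only
  rw [natCard_units_subtype_eq hdiv
    (fun b : B => b ∈ L ∧ ((reducedNorm ℚ B b : ℚ) : ℝ) ≤ (N : ℝ) * c)]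
  have e : Nat.card {b : B // b ≠ 0 ∧ (b ∈ L ∧ ((reducedNorm ℚ B b : ℚ) : ℝ) ≤ N * c)} =
      ({b : B | b ≠ 0 ∧ (b ∈ L ∧ ((reducedNorm ℚ B b : ℚ) : ℝ) ≤ N * c)}).ncard :=
    Nat.card_coe_set_eq _
  rw [e, ncard_setOf_mem_reducedNorm_le_eq_succ hdef hL hNc]
  push_cast
  ring

end General

/-! ### §D. Summing over the class set (Voight (25.3.14)): the mass formula -/

namespace EichlerPackage

variable {Nplus Nminus : ℕ} (P : EichlerPackage Nplus Nminus)

/-- **The integral ideals of one class** (Voight Prop. 25.3.11): for an invertible right `O`-ideal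
`I` of an Eichler package of level `(N⁺, N⁻)`,
`#{J ⊆ O : J ∼ I, [O : J] = n², n ≤ N} / N² → 2π² / (N⁺ N⁻ · #Stab(I)) = π² / (N⁺ N⁻ w_I)`. [cite: Voight2021, Prop. 25.3.11 and (25.3.12)–(25.3.13)] -/
theorem tendsto_ncard_classIdeals_div_sq (hsq : Squarefree Nminus)
    {I : Submodule ℤ P.B} (hI : IsInvertibleRightIdeal P.O I) :
    Tendsto (fun N : ℕ => (({J : Submodule ℤ P.B | (∃ b : (P.B)ˣ, J = b • I) ∧ (J ≤ P.O ∧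
        ∃ n ∈ Icc 1 N, J.toAddSubgroup.relIndex P.O.toAddSubgroup = n ^ 2)}).ncard : ℝ) /
        (N : ℝ) ^ 2) atTop
      (𝓝 (2 * π ^ 2 / ((Nplus : ℝ) * Nminus) / Nat.card (MulAction.stabilizer (P.B)ˣ I))) := by
  classical
  have hdef := P.isTotallyDefinite
  have hdiv := P.forall_isUnit
  have hO := P.isZOrder_O
  obtain ⟨ψ, hψn, hψs⟩ := exists_euclideanEmbedding (B := P.B) hdef
  have hLfull : IsFullLattice P.B (transporterLeft I P.O) := isFullLattice_transporterLeft hdiv hO hI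
  have hIfull := hI.isFullLattice
  have hcovO := covol_pos ψ hψs hO.isFullLattice (L := P.O)
  have hcovI := covol_pos ψ hψs hIfull (L := I)
  have hcovL := covol_pos ψ hψs hLfull (L := transporterLeft I P.O)
  set c : ℝ := Real.sqrt (covol ψ P.O / covol ψ I) with hc_def
  have hc : 0 < c := Real.sqrt_pos.mpr (div_pos hcovO hcovI)
  have hc2 : c ^ 2 = covol ψ P.O / covol ψ I := Real.sq_sqrt (div_pos hcovO hcovI).le
  -- the stabiliser is finite and non-trivial
  haveI hfinS : Finite (MulAction.stabilizer (P.B)ˣ I) :=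
    finite_stabilizer_of_isTotallyDefinite hdef hIfull
  have hS0 : (Nat.card (MulAction.stabilizer (P.B)ˣ I) : ℝ) ≠ 0 := by
    exact_mod_cast (Nat.card_pos (α := MulAction.stabilizer (P.B)ˣ I)).ne'
  -- the count identity, for every `N`
  have hcount : ∀ N : ℕ, (({J : Submodule ℤ P.B | (∃ b : (P.B)ˣ, J = b • I) ∧ (J ≤ P.O ∧
      ∃ n ∈ Icc 1 N, J.toAddSubgroup.relIndex P.O.toAddSubgroup = n ^ 2)}).ncard : ℝ) =
      (Nat.card {g : (P.B)ˣ // (g : P.B) ∈ transporterLeft I P.O ∧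
        ((reducedNorm ℚ P.B (g : P.B) : ℚ) : ℝ) ≤ N * c} : ℝ) /
        Nat.card (MulAction.stabilizer (P.B)ˣ I) := by
    intro N
    rw [eq_div_iff hS0]
    set T : Set (Submodule ℤ P.B) := {J | (∃ b : (P.B)ˣ, J = b • I) ∧ (J ≤ P.O ∧
      ∃ n ∈ Icc 1 N, J.toAddSubgroup.relIndex P.O.toAddSubgroup = n ^ 2)} with hT
    have hTorb : T ⊆ MulAction.orbit (P.B)ˣ I := by
      rintro J ⟨⟨b, rfl⟩, -⟩
      exact MulAction.mem_orbit I b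
    have h1 := natCard_subtype_smul_mem_eq I T hTorb
    have h2 : Nat.card {g : (P.B)ˣ // g • I ∈ T} =
        Nat.card {g : (P.B)ˣ // g • I ≤ P.O ∧ ∃ n ∈ Icc 1 N,
          (g • I).toAddSubgroup.relIndex P.O.toAddSubgroup = n ^ 2} := by
      refine Nat.card_congr (Equiv.subtypeEquivRight fun g => ?_)
      simp only [hT, Set.mem_setOf_eq]
      exact ⟨fun h => h.2, fun h => ⟨⟨g, rfl⟩, h⟩⟩
    rw [h2, natCard_units_smul_le_eq hdef ψ hψs hψn hO hI hc hc2 N] at h1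
    rw [← Nat.card_coe_set_eq T]
    exact_mod_cast h1.symm
  -- the value of the limit
  have hval : π ^ 2 / 2 / covol ψ (transporterLeft I P.O) * c ^ 2 /
      Nat.card (MulAction.stabilizer (P.B)ˣ I) =
      2 * π ^ 2 / ((Nplus : ℝ) * Nminus) / Nat.card (MulAction.stabilizer (P.B)ˣ I) := by
    congr 1
    have hprod := covol_transporterLeft_mul_covol hdef ψ hψs hψn hO hI
    have hO4 := covol_eichler_eq hdef hsq P.mem_ramifiedPlaces_iff P.isEichlerOrder ψ hψs hψn
    have hNp : (Nplus : ℝ) ≠ 0 := by exact_mod_cast P.nplus_pos'.ne'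
    have hNm : (Nminus : ℝ) ≠ 0 := by exact_mod_cast P.nminus_ne_zero
    have hcL : covol ψ (transporterLeft I P.O) = covol ψ P.O ^ 2 / covol ψ I := by
      rw [← hprod]; field_simp
    rw [hc2, hcL, hO4]
    field_simp
    ring
  have hlim := (tendsto_natCard_units_mem_div_sq hdef ψ hψs hψn hLfull hc).div_const
    (Nat.card (MulAction.stabilizer (P.B)ˣ I) : ℝ)
  rw [hval] at hlim
  refine hlim.congr fun N => ?_
  rw [hcount N, div_div, div_div, mul_comm ((N : ℝ) ^ 2)]

/-- **`∑_{n ≤ N} a(n)` splits over the class set**: the integral invertible right `O`-ideals of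
norm `≤ N` are the disjoint union over `[I] ∈ Cls O` of those of the form `b I`, `I` the chosen
representative (Voight (25.3.8)). [cite: Voight2021, §25.3 (25.3.8)] -/
theorem sum_card_integralIdeals_eq_sum_ncard (N : ℕ) :
    (∑ n ∈ Icc 1 N, (Nat.card {I : invertibleRightIdeals P.O // (I : Submodule ℤ P.B) ≤ P.O ∧
        (I : Submodule ℤ P.B).toAddSubgroup.relIndex P.O.toAddSubgroup = n ^ 2} : ℝ)) =
      ∑ i : P.brandtData.ι, (({J : Submodule ℤ P.B |
        (∃ b : (P.B)ˣ, J = b • RightIdealClass.rep i) ∧ (J ≤ P.O ∧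
          ∃ n ∈ Icc 1 N, J.toAddSubgroup.relIndex P.O.toAddSubgroup = n ^ 2)}).ncard : ℝ) := by
  classical
  haveI : IsAddTorsionFree P.B := isAddTorsionFree_of_charZero_module ℚ P.B
  have hO := P.isZOrder_O
  -- Step 1: `∑_n a(n) = #A_N`
  set Q : ℕ → Submodule ℤ P.B → Prop := fun n J => IsInvertibleRightIdeal P.O J ∧ J ≤ P.O ∧
    J.toAddSubgroup.relIndex P.O.toAddSubgroup = n ^ 2 with hQ
  have hfin : ∀ n ∈ Icc 1 N, {J | Q n J}.Finite := by
    intro n hn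
    have hn0 : n ^ 2 ≠ 0 := pow_ne_zero 2 (by have := (Finset.mem_Icc.mp hn).1; omega)
    refine (finite_setOf_le_and_relIndex_eq P.O hO.isFullLattice.1 hn0).subset ?_
    rintro J ⟨-, hJO, hidx⟩
    exact ⟨hJO, hidx⟩
  have huniq : ∀ J n n', Q n J → Q n' J → n = n' := by
    rintro J n n' ⟨-, -, h⟩ ⟨-, -, h'⟩
    exact Nat.pow_left_injective (by norm_num) (h.symm.trans h')
  obtain ⟨hAfin, hAcard⟩ := ncard_setOf_exists_mem_finset_eq_sum (Icc 1 N) Q hfin huniq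
  have hstep1 : ∑ n ∈ Icc 1 N, (Nat.card {I : invertibleRightIdeals P.O //
      (I : Submodule ℤ P.B) ≤ P.O ∧
        (I : Submodule ℤ P.B).toAddSubgroup.relIndex P.O.toAddSubgroup = n ^ 2} : ℝ) =
      (({J | ∃ n ∈ Icc 1 N, Q n J}).ncard : ℝ) := by
    rw [hAcard, Nat.cast_sum]
    refine Finset.sum_congr rfl fun n _ => ?_
    congr 1
    rw [← Nat.card_coe_set_eq]
    refine Nat.card_congr ?_
    exact { toFun := fun I => ⟨I.1.1, I.1.2, I.2⟩
            invFun := fun I => ⟨⟨I.1, I.2.1⟩, I.2.2⟩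
            left_inv := fun I => rfl
            right_inv := fun I => rfl }
  -- Step 2: `#A_N = ∑_i #T_i(N)`
  set R : P.brandtData.ι → Submodule ℤ P.B → Prop := fun i J =>
    (∃ b : (P.B)ˣ, J = b • RightIdealClass.rep i) ∧ (J ≤ P.O ∧
      ∃ n ∈ Icc 1 N, J.toAddSubgroup.relIndex P.O.toAddSubgroup = n ^ 2) with hR
  have hAR : {J | ∃ n ∈ Icc 1 N, Q n J} = {J | ∃ i ∈ (Finset.univ : Finset P.brandtData.ι), R i J} := by
    ext J
    simp only [hQ, hR, Set.mem_setOf_eq, Finset.mem_univ, true_and]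
    constructor
    · rintro ⟨n, hn, hJ, hJO, hidx⟩
      refine ⟨RightIdealClass.mk ⟨J, hJ⟩, ?_, hJO, n, hn, hidx⟩
      have h := (RightIdealClass.mk_eq_mk_iff (O := P.O)
        (I := ⟨RightIdealClass.rep (RightIdealClass.mk ⟨J, hJ⟩),
          RightIdealClass.isInvertibleRightIdeal_rep _⟩) (J := ⟨J, hJ⟩)).mp
        (RightIdealClass.mk_rep _)
      exact h
    · rintro ⟨i, ⟨b, rfl⟩, hJO, n, hn, hidx⟩
      exact ⟨n, hn, (RightIdealClass.isInvertibleRightIdeal_rep i).units_smul b, hJO, hidx⟩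
  have hRfin : ∀ i ∈ (Finset.univ : Finset P.brandtData.ι), {J | R i J}.Finite := by
    intro i _
    refine hAfin.subset ?_
    rintro J ⟨⟨b, rfl⟩, hJO, n, hn, hidx⟩
    exact ⟨n, hn, (RightIdealClass.isInvertibleRightIdeal_rep i).units_smul b, hJO, hidx⟩
  have hRuniq : ∀ J i j, R i J → R j J → i = j := by
    rintro J i j ⟨⟨b, rfl⟩, -⟩ ⟨⟨b', hb'⟩, -⟩
    have hi : RightIdealClass.mk ⟨b • RightIdealClass.rep i,
        (RightIdealClass.isInvertibleRightIdeal_rep i).units_smul b⟩ = i := by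
      rw [RightIdealClass.mk_units_smul b ⟨_, RightIdealClass.isInvertibleRightIdeal_rep i⟩,
        RightIdealClass.mk_rep]
    have hj : RightIdealClass.mk ⟨b' • RightIdealClass.rep j,
        (RightIdealClass.isInvertibleRightIdeal_rep j).units_smul b'⟩ = j := by
      rw [RightIdealClass.mk_units_smul b' ⟨_, RightIdealClass.isInvertibleRightIdeal_rep j⟩,
        RightIdealClass.mk_rep]
    rw [← hi, ← hj]
    congr 1
    exact Subtype.ext hb'
  obtain ⟨-, hRcard⟩ := ncard_setOf_exists_mem_finset_eq_sum Finset.univ R hRfin hRuniq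
  rw [hstep1, hAR, hRcard, Nat.cast_sum]

/-- **Eichler's mass formula, unit-group form**: `∑_{[I] ∈ Cls O} 1 / #O_ℓ(I)ˣ =
(1/24) ∏_{q ∣ N⁻} (q - 1) ∏_{p^k ∥ N⁺} p^{k-1}(p + 1)` for an Eichler package of level
`(N⁺, N⁻)`, `N⁺ ≥ 1`, `N⁻` squarefree — comparison of the two asymptotics of `∑_{n ≤ N} a(n)`
(Voight (25.3.14)). [cite: Voight2021, Thm. 25.3.18 and (25.3.14)] -/
theorem sum_inv_natCard_stabilizer_eq (hN : 0 < Nplus) (hsq : Squarefree Nminus) :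
    ∑ i : P.brandtData.ι, (1 : ℝ) / Nat.card (MulAction.stabilizer (P.B)ˣ (RightIdealClass.rep i)) =
      (1 / 24 : ℝ) * ((∏ q ∈ Nminus.primeFactors, ((q : ℝ) - 1)) *
        ∏ p ∈ Nplus.primeFactors, ((p : ℝ) ^ (Nplus.factorization p - 1) * ((p : ℝ) + 1))) := by
  classical
  have hA := P.tendsto_sum_card_integralIdeals_div_sq hN
  have hD : Tendsto (fun N : ℕ => (∑ n ∈ Icc 1 N, (Nat.card {I : invertibleRightIdeals P.O //
        (I : Submodule ℤ P.B) ≤ P.O ∧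
          (I : Submodule ℤ P.B).toAddSubgroup.relIndex P.O.toAddSubgroup = n ^ 2} : ℝ)) /
        (N : ℝ) ^ 2) atTop
      (𝓝 (∑ i : P.brandtData.ι, 2 * π ^ 2 / ((Nplus : ℝ) * Nminus) /
        Nat.card (MulAction.stabilizer (P.B)ˣ (RightIdealClass.rep i)))) := by
    have h := tendsto_finsetSum (Finset.univ : Finset P.brandtData.ι)
      (fun i _ => P.tendsto_ncard_classIdeals_div_sq hsq
        (RightIdealClass.isInvertibleRightIdeal_rep i))
    refine h.congr fun N => ?_
    rw [P.sum_card_integralIdeals_eq_sum_ncard N, Finset.sum_div]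
  have heq := tendsto_nhds_unique hD hA
  -- arithmetic
  have hNp : (Nplus : ℝ) ≠ 0 := by exact_mod_cast hN.ne'
  have hNm : (Nminus : ℝ) ≠ 0 := by exact_mod_cast P.nminus_ne_zero
  have hπ : (π : ℝ) ≠ 0 := Real.pi_pos.ne'
  set S := ∑ i : P.brandtData.ι, (1 : ℝ) /
    Nat.card (MulAction.stabilizer (P.B)ˣ (RightIdealClass.rep i)) with hS
  set X := ∏ q ∈ Nminus.primeFactors, (((q : ℝ) - 1) / q) with hX
  set Y := ∏ p ∈ Nplus.primeFactors, (((p : ℝ) + 1) / p) with hY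
  have hsum : ∑ i : P.brandtData.ι, 2 * π ^ 2 / ((Nplus : ℝ) * Nminus) /
      Nat.card (MulAction.stabilizer (P.B)ˣ (RightIdealClass.rep i)) =
      2 * π ^ 2 / ((Nplus : ℝ) * Nminus) * S := by
    rw [hS, Finset.mul_sum]
    refine Finset.sum_congr rfl fun i _ => ?_
    rw [mul_one_div]
  rw [hsum] at heq
  have hSval : S = (Nplus : ℝ) * Nminus / 24 * (X * Y) := by
    have h2 : (2 : ℝ) * π ^ 2 / ((Nplus : ℝ) * Nminus) ≠ 0 := by positivity
    have : S = π ^ 2 / 12 * (X * Y) / (2 * π ^ 2 / ((Nplus : ℝ) * Nminus)) := by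
      rw [← heq]; field_simp
    rw [this]
    field_simp
    ring
  -- `N⁻ ∏ (q-1)/q = ∏ (q-1)` and `N⁺ ∏ (p+1)/p = ∏ p^{k-1}(p+1)`
  have hXval : (Nminus : ℝ) * X = ∏ q ∈ Nminus.primeFactors, ((q : ℝ) - 1) := by
    have hprod : ((∏ q ∈ Nminus.primeFactors, q : ℕ) : ℝ) = Nminus := by
      exact_mod_cast Nat.prod_primeFactors_of_squarefree hsq
    rw [← hprod, Nat.cast_prod, hX, ← Finset.prod_mul_distrib]
    refine Finset.prod_congr rfl fun q hq => ?_
    have hq0 : (q : ℝ) ≠ 0 := by exact_mod_cast (Nat.prime_of_mem_primeFactors hq).ne_zero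
    field_simp
  have hYval : (Nplus : ℝ) * Y =
      ∏ p ∈ Nplus.primeFactors, ((p : ℝ) ^ (Nplus.factorization p - 1) * ((p : ℝ) + 1)) := by
    have hprod : ((∏ p ∈ Nplus.primeFactors, p ^ Nplus.factorization p : ℕ) : ℝ) = Nplus := by
      exact_mod_cast Nat.prod_factorization_pow_eq_self hN.ne'
    rw [← hprod, Nat.cast_prod, hY, ← Finset.prod_mul_distrib]
    refine Finset.prod_congr rfl fun p hp => ?_
    have hpp := Nat.prime_of_mem_primeFactors hp
    have hp0 : (p : ℝ) ≠ 0 := by exact_mod_cast hpp.ne_zero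
    have hk : 1 ≤ Nplus.factorization p :=
      hpp.factorization_pos_of_dvd hN.ne' (Nat.dvd_of_mem_primeFactors hp)
    obtain ⟨k, hk'⟩ := Nat.exists_eq_add_of_le hk
    rw [hk', Nat.add_sub_cancel_left, Nat.cast_pow, pow_add, pow_one]
    field_simp
  rw [hSval, ← hXval, ← hYval]
  ring

/-- **Eichler's mass formula** for an Eichler package of level `(N⁺, N⁻)` (`N⁺ ≥ 1`, `N⁻`
squarefree): `∑_{[I] ∈ Cls O} 1 / w_I = (1/12) ∏_{q ∣ N⁻} (q - 1) ∏_{p^k ∥ N⁺} p^{k-1} (p + 1)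
= φ(N⁻) ψ(N⁺) / 12` with the Brandt weights `w_I = #O_ℓ(I)ˣ / 2` of `BrandtData.ofOrder`.
[cite: Voight2021, Thm. 25.3.18] [cite: VignerasLNM800, Ch. V §2 Cor. 2.3] -/
theorem massFormula (hN : 0 < Nplus) (hsq : Squarefree Nminus) :
    ∑ i : P.brandtData.ι, (1 : ℚ) / P.brandtData.w i =
      (1 / 12 : ℚ) * (∏ q ∈ Nminus.primeFactors, ((q : ℚ) - 1)) *
        ∏ p ∈ Nplus.primeFactors, (p : ℚ) ^ (Nplus.factorization p - 1) * ((p : ℚ) + 1) := by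
  have h := P.sum_inv_natCard_stabilizer_eq hN hsq
  have hw : ∀ i : P.brandtData.ι, (P.brandtData.w i : ℝ) =
      (Nat.card (MulAction.stabilizer (P.B)ˣ (RightIdealClass.rep i)) : ℝ) / 2 := by
    intro i
    have hwi : P.brandtData.w i =
        Nat.card (MulAction.stabilizer (P.B)ˣ (RightIdealClass.rep i)) / 2 := rfl
    have h2 := natCard_stabilizer_eq_two_mul (B := P.B) (RightIdealClass.rep i)
    rw [hwi, eq_div_iff (two_ne_zero' ℝ)]
    exact_mod_cast (by omega :
      Nat.card (MulAction.stabilizer (P.B)ˣ (RightIdealClass.rep i)) / 2 * 2 =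
        Nat.card (MulAction.stabilizer (P.B)ˣ (RightIdealClass.rep i)))
  have hmain : ((∑ i : P.brandtData.ι, (1 : ℚ) / P.brandtData.w i : ℚ) : ℝ) =
      (((1 / 12 : ℚ) * (∏ q ∈ Nminus.primeFactors, ((q : ℚ) - 1)) *
        ∏ p ∈ Nplus.primeFactors, (p : ℚ) ^ (Nplus.factorization p - 1) * ((p : ℚ) + 1) : ℚ) : ℝ) := by
    push_cast
    have hterm : ∀ i ∈ (Finset.univ : Finset P.brandtData.ι), (1 : ℝ) / (P.brandtData.w i : ℝ) =
        2 * (1 / (Nat.card (MulAction.stabilizer (P.B)ˣ (RightIdealClass.rep i)) : ℝ)) := by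
      intro i _
      rw [hw i, one_div_div]
      ring
    rw [Finset.sum_congr rfl hterm, ← Finset.mul_sum, h]
    ring
  exact_mod_cast hmain

end EichlerPackage

/-- **Eichler's mass formula over `ℚ` at every level `(N⁺, N⁻)`** — the discharge of the tree's
named fact `brandtModule_massFormula` (`BrandtModule.lean`): for every Eichler package `P` of level
`(N⁺, N⁻)` with `N⁺ ≥ 1` and `N⁻` squarefree,
`∑_i 1 / w_i = (1/12) ∏_{q ∣ N⁻} (q - 1) ∏_{p^k ∥ N⁺} p^{k-1} (p + 1)`. [cite: Voight2021, Thm. 25.3.18] [cite: VignerasLNM800, Ch. V §2 Cor. 2.3 (formule de masse d'Eichler)] -/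
theorem brandtModule_massFormula_holds : brandtModule_massFormula := by
  intro Nplus Nminus P hN hsq
  exact P.massFormula hN hsq

end Literature.NumberTheory.Automorphic
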